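import Literature.Analysis.FluidPDE.OseenPotentialDeformedBound
import Literature.Analysis.FluidPDE.NSBoundedMildOseenDuhamel
import Literature.Analysis.FluidPDE.OseenSchemeComplex
import Literature.Analysis.FluidPDE.OseenSlice
import Literature.Analysis.Complex.HolomorphicParametricIntegral
import HarnessLib

/-!
# Flat complex continuations of Oseen space potentials and of the Oseen–Duhamel term

Analysis/FluidPDE definitions-layer file for the proof of the named fact
`Literature.Analysis.FluidPDE.bradshawGrujicKukavica2015_local_analyticity_radius`
(Bradshaw–Grujić–Kukavica 2015, Thm. 2.3, §3–§4; Grujić–Kukavica 1998, §2). For real densities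
`u, v : ℝ^ι → ℝ^ι` and a real root time `ρ = √τ` we define the **flat continuation of the Oseen
space potential**

  `oseenFlatC ρ u v ζ = ∫ oseenKernelC ρ (ζ - cx w) [cx (u w), cx (v w)] dw`      (`ζ ∈ ℂ^ι`)

(`oseenKernelC` the complexified Koch–Tataru kernel of `e^{τΔ}P∇·`, `OseenKernelComplex.lean`;
"flat": the contour stays `ℝ^ι`) and the **flat continuation of the Oseen–Duhamel term**

  `oseenDuhamelFlatC s₀ u v t ζ = ∫_{(s₀,t)} oseenFlatC √(t-s) (u s) (v s) ζ ds`   (`ν = 1`).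

These are the objects iterated by the complexified Picard scheme (Grujić–Kukavica: the iterates
`u⁽ⁿ⁺¹⁾ = u₀-part - B(u⁽ⁿ⁾, u⁽ⁿ⁾)` are continued by continuing the kernels, the densities being the
*real* previous iterates). We prove:

* **real restriction** (`oseenFlatC_sqrt_complexify`, `oseenDuhamelFlatC_complexify`):
  at `ζ = cx x` they are `cx` of `oseenSlice τ u v x` and of `oseenDuhamel 1 s₀ u v t x`;
* **the off-diagonal (annular) bound** (`exists_norm_oseenFlatC_le_of_support`): if, wherever both
  densities are non-zero, the imaginary part is admissible, `‖y‖ ≤ ‖x - w‖/2 + ρ`, then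
  `‖oseenFlatC ρ u v (cx x + i cx y)‖ ≤ C M_u M_v / ρ` (the sector bounds of
  `OseenKernelSectorBounds.lean`, with the shift switched off where a density vanishes);
* **the deformed-contour bound** (`exists_norm_oseenFlatC_le_of_holomorphic`): the estimate of
  `OseenPotentialDeformedBound.lean` in the present notation — if `u, v` are the real traces of
  fields `A, B` holomorphic on a neighbourhood accommodating the deformation graphs, then
  `‖oseenFlatC ρ u v (cx x + i cx y)‖ ≤ (1 + L) C M_A M_B / ρ`;
* **time integration** (`norm_oseenDuhamelFlatC_le_of_forall`): pointwise-in-`s` bounds `K/√(t-s)`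
  integrate to `2K√(t - s₀)`.

Holomorphy in `ζ` and joint measurability are in the companion proofs-layer file.

## References

* Z. Grujić, I. Kukavica, *Space analyticity for the Navier–Stokes and related equations with
  initial data in `Lᵖ`*, J. Funct. Anal. 152 (1998), §2. [GrujicKukavica1998]
* Z. Bradshaw, Z. Grujić, I. Kukavica, J. Differential Equations 259 (2015), §3 (3.1)–(3.3),
  Lemma 3.2, §4. [BradshawGrujicKukavica2015]
* H. Koch, D. Tataru, Adv. Math. 157 (2001), §2 (6)–(8), (14). [KochTataruAdvMath2001]
-/

noncomputable section

open MeasureTheory Set Filter Metric Real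
open _root_.Topology
open scoped BigOperators ENNReal

namespace Literature.Analysis.FluidPDE

open Literature.Analysis.FunctionSpaces.EuclideanSpace (complexify complexify_apply norm_complexify
  continuous_complexify)

variable {ι : Type*} [Fintype ι]

/-! ### Definitions -/

/-- **The flat continuation of the Oseen space potential** of real densities `u, v` at real root
time `ρ`: `oseenFlatC ρ u v ζ = ∫ oseenKernelC ρ (ζ - cx w) [cx (u w), cx (v w)] dw`. At `ρ = √τ`,
`ζ = cx x` it is `cx (oseenSlice τ u v x)` (`oseenFlatC_sqrt_complexify`). [cite: GrujicKukavica1998, §2] -/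
def oseenFlatC (ρ : ℝ) (u v : EuclideanSpace ℝ ι → EuclideanSpace ℝ ι) (ζ : EuclideanSpace ℂ ι) :
    EuclideanSpace ℂ ι :=
  ∫ w, oseenKernelC (ρ : ℂ) (ζ - complexify w) (complexify (u w)) (complexify (v w))

/-- **The flat continuation of the Oseen–Duhamel term** (`ν = 1`, base time `s₀`):
`oseenDuhamelFlatC s₀ u v t ζ = ∫_{(s₀,t)} oseenFlatC √(t-s) (u s) (v s) ζ ds`. At `ζ = cx x` it is
`cx (oseenDuhamel 1 s₀ u v t x)` (`oseenDuhamelFlatC_complexify`). [cite: BradshawGrujicKukavica2015, §3 (3.1)–(3.3)] -/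
def oseenDuhamelFlatC (s₀ : ℝ) (u v : ℝ → EuclideanSpace ℝ ι → EuclideanSpace ℝ ι) (t : ℝ)
    (ζ : EuclideanSpace ℂ ι) : EuclideanSpace ℂ ι :=
  ∫ s in Ioo s₀ t, oseenFlatC (Real.sqrt (t - s)) (u s) (v s) ζ

/-- Unfolding lemma. [folklore] -/
theorem oseenFlatC_apply (ρ : ℝ) (u v : EuclideanSpace ℝ ι → EuclideanSpace ℝ ι)
    (ζ : EuclideanSpace ℂ ι) :
    oseenFlatC ρ u v ζ =
      ∫ w, oseenKernelC (ρ : ℂ) (ζ - complexify w) (complexify (u w)) (complexify (v w)) := rfl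

/-- Unfolding lemma. [folklore] -/
theorem oseenDuhamelFlatC_apply (s₀ : ℝ) (u v : ℝ → EuclideanSpace ℝ ι → EuclideanSpace ℝ ι)
    (t : ℝ) (ζ : EuclideanSpace ℂ ι) :
    oseenDuhamelFlatC s₀ u v t ζ = ∫ s in Ioo s₀ t, oseenFlatC (Real.sqrt (t - s)) (u s) (v s) ζ := rfl

/-! ### Real restriction -/

/-- **Real restriction of the flat potential**: `oseenFlatC √τ u v (cx x) = cx (oseenSlice τ u v x)`
for `τ > 0`. [folklore] -/
theorem oseenFlatC_sqrt_complexify {τ : ℝ} (hτ : 0 < τ) (u v : EuclideanSpace ℝ ι → EuclideanSpace ℝ ι)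
    (x : EuclideanSpace ℝ ι) :
    oseenFlatC (Real.sqrt τ) u v (complexify x) = complexify (oseenSlice τ u v x) := by
  rw [oseenFlatC_apply, oseenSlice_apply,
    ← (complexify (ι := ι)).integral_comp_comm (fun w => oseenKernel τ (x - w) (u w) (v w))]
  refine integral_congr_ae (Eventually.of_forall fun w => ?_)
  show oseenKernelC (Real.sqrt τ : ℂ) (complexify x - complexify w) (complexify (u w)) (complexify (v w)) =
    complexify (oseenKernel τ (x - w) (u w) (v w))
  rw [← map_sub, oseenKernelC_sqrt_complexify hτ]

/-- **Real restriction of the flat Duhamel term**: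
`oseenDuhamelFlatC s₀ u v t (cx x) = cx (oseenDuhamel 1 s₀ u v t x)`. [folklore] -/
theorem oseenDuhamelFlatC_complexify (s₀ : ℝ) (u v : ℝ → EuclideanSpace ℝ ι → EuclideanSpace ℝ ι)
    (t : ℝ) (x : EuclideanSpace ℝ ι) :
    oseenDuhamelFlatC s₀ u v t (complexify x) = complexify (oseenDuhamel 1 s₀ u v t x) := by
  rw [oseenDuhamelFlatC_apply, oseenDuhamel_apply,
    ← (complexify (ι := ι)).integral_comp_comm]
  refine setIntegral_congr_fun measurableSet_Ioo fun s hs => ?_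
  show oseenFlatC (Real.sqrt (t - s)) (u s) (v s) (complexify x) =
    complexify (∫ y, oseenKernel (1 * (t - s)) (x - y) (u s y) (v s y))
  rw [oseenFlatC_sqrt_complexify (sub_pos.2 hs.2), oseenSlice_apply, one_mul]

/-! ### The integrand: vanishing, measurability -/

/-- The flat integrand vanishes where a density vanishes (first slot). [folklore] -/
theorem oseenKernelC_complexify_zero_left (m : ℂ) (ξ : EuclideanSpace ℂ ι) (b : EuclideanSpace ℂ ι) :
    oseenKernelC m ξ (complexify (0 : EuclideanSpace ℝ ι)) b = 0 := by
  have h := oseenKernelC_sub_left m ξ (complexify (0 : EuclideanSpace ℝ ι)) (complexify 0) b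
  rw [sub_self, map_zero, sub_self] at h
  rw [map_zero]
  exact h

/-- The flat integrand vanishes where a density vanishes (second slot). [folklore] -/
theorem oseenKernelC_complexify_zero_right (m : ℂ) (ξ a : EuclideanSpace ℂ ι) :
    oseenKernelC m ξ a (complexify (0 : EuclideanSpace ℝ ι)) = 0 := by
  have h := oseenKernelC_sub_right m ξ a (complexify (0 : EuclideanSpace ℝ ι)) (complexify 0)
  rw [sub_self, map_zero, sub_self] at h
  rw [map_zero]
  exact h

/-- For `ρ ≠ 0` the complexified kernel is jointly continuous in `(ξ, a, b)`. [folklore] -/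
theorem continuous_oseenKernelC_of_ne_zero {ρ : ℝ} (hρ : ρ ≠ 0) :
    Continuous fun q : EuclideanSpace ℂ ι × EuclideanSpace ℂ ι × EuclideanSpace ℂ ι =>
      oseenKernelC (ρ : ℂ) q.1 q.2.1 q.2.2 := by
  have hd : Differentiable ℂ fun q : EuclideanSpace ℂ ι × EuclideanSpace ℂ ι × EuclideanSpace ℂ ι =>
      oseenKernelC (ρ : ℂ) q.1 q.2.1 q.2.2 := fun q =>
    (differentiableAt_const _).oseenKernelC differentiableAt_fst (differentiableAt_snd.fst)
      (differentiableAt_snd.snd) (Complex.ofReal_ne_zero.2 hρ)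
  exact hd.continuous

/-- Measurability in `w` of the flat integrand for measurable densities (`ρ ≠ 0`). [folklore] -/
theorem aestronglyMeasurable_oseenFlatC_integrand {u v : EuclideanSpace ℝ ι → EuclideanSpace ℝ ι}
    (hu : AEStronglyMeasurable u volume) (hv : AEStronglyMeasurable v volume) {ρ : ℝ} (hρ : ρ ≠ 0)
    (ζ : EuclideanSpace ℂ ι) :
    AEStronglyMeasurable (fun w => oseenKernelC (ρ : ℂ) (ζ - complexify w) (complexify (u w))
      (complexify (v w))) volume := by
  have h1 : AEStronglyMeasurable (fun w : EuclideanSpace ℝ ι => ζ - complexify w) volume :=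
    (continuous_const.sub (continuous_complexify (ι := ι))).aestronglyMeasurable
  have h2 : AEStronglyMeasurable (fun w : EuclideanSpace ℝ ι => complexify (u w)) volume :=
    continuous_complexify.comp_aestronglyMeasurable hu
  have h3 : AEStronglyMeasurable (fun w : EuclideanSpace ℝ ι => complexify (v w)) volume :=
    continuous_complexify.comp_aestronglyMeasurable hv
  have h5 := (continuous_oseenKernelC_of_ne_zero hρ).comp_aestronglyMeasurable (h1.prodMk (h2.prodMk h3))
  -- normalise the composite before closing (a bare `exact` makes the unifier unfold the kernel)
  dsimp only at h5
  exact h5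

/-! ### The off-diagonal (annular) bound -/

/-- The displacement `cx x + i cx y - cx w = cx (x - w) - i cx (-y)`. [folklore] -/
theorem complexify_add_I_smul_sub' (x y w : EuclideanSpace ℝ ι) :
    complexify x + Complex.I • complexify y - complexify w =
      complexify (x - w) - Complex.I • complexify (-y) := by
  rw [map_sub, LinearIsometry.map_neg, smul_neg, sub_neg_eq_add]
  abel

/-- **The off-diagonal bound for flat Oseen potentials.** There is `C = C(ι) > 0` (the constant of
`exists_lintegral_oseenKernelC_imShift_le`) such that for `ρ > 0`, real `x, y`, and densities
bounded by `M_u, M_v` for which the imaginary part is admissible wherever both are non-zero,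
`u w ≠ 0 → v w ≠ 0 → ‖y‖ ≤ ‖x - w‖/2 + ρ`, one has
`‖oseenFlatC ρ u v (cx x + i cx y)‖ ≤ C M_u M_v / ρ`. (Where a density vanishes the imaginary
shift may be switched off without changing the integrand.) [cite: KochTataruAdvMath2001, §2 (14)] -/
theorem exists_norm_oseenFlatC_le_of_support :
    ∃ C : ℝ, 0 < C ∧ ∀ {ρ : ℝ}, 0 < ρ → ∀ (x y : EuclideanSpace ℝ ι)
      {u v : EuclideanSpace ℝ ι → EuclideanSpace ℝ ι} {Mu Mv : ℝ}, 0 ≤ Mu → 0 ≤ Mv →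
      (∀ w, ‖u w‖ ≤ Mu) → (∀ w, ‖v w‖ ≤ Mv) →
      (∀ w, u w ≠ 0 → v w ≠ 0 → ‖y‖ ≤ ‖x - w‖ / 2 + ρ) →
        ‖oseenFlatC ρ u v (complexify x + Complex.I • complexify y)‖ ≤ C * Mu * Mv / ρ := by
  classical
  obtain ⟨C, hC, hK⟩ := exists_lintegral_oseenKernelC_imShift_le (ι := ι)
  refine ⟨C, hC, fun {ρ} hρ x y {u v Mu Mv} hMu hMv hu hv hadm => ?_⟩
  -- the modified shift: `-y` where both densities are non-zero, `0` elsewhere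
  set η : EuclideanSpace ℝ ι → EuclideanSpace ℝ ι := fun w => if u w ≠ 0 ∧ v w ≠ 0 then -y else 0
    with hη
  have hηadm : ∀ w, ‖η w‖ ≤ ‖x - w‖ / 2 + ρ := by
    intro w
    by_cases hw : u w ≠ 0 ∧ v w ≠ 0
    · show ‖(if u w ≠ 0 ∧ v w ≠ 0 then -y else 0)‖ ≤ ‖x - w‖ / 2 + ρ
      rw [if_pos hw, norm_neg]
      exact hadm w hw.1 hw.2
    · show ‖(if u w ≠ 0 ∧ v w ≠ 0 then -y else 0)‖ ≤ ‖x - w‖ / 2 + ρ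
      rw [if_neg hw, norm_zero]
      positivity
  have hpt : ∀ w, oseenKernelC (ρ : ℂ) (complexify x + Complex.I • complexify y - complexify w)
      (complexify (u w)) (complexify (v w)) =
      oseenKernelC (ρ : ℂ) (complexify (x - w) - Complex.I • complexify (η w))
        (complexify (u w)) (complexify (v w)) := by
    intro w
    by_cases hw : u w ≠ 0 ∧ v w ≠ 0
    · rw [complexify_add_I_smul_sub', show η w = -y from if_pos hw]
    · rw [not_and_or, not_not, not_not] at hw
      rcases hw with h0 | h0
      · rw [h0, oseenKernelC_complexify_zero_left, oseenKernelC_complexify_zero_left]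
      · rw [h0, oseenKernelC_complexify_zero_right, oseenKernelC_complexify_zero_right]
  have h := hK hρ x hηadm (A := fun w => complexify (u w)) (B := fun w => complexify (v w)) hMu hMv
    (fun w => by rw [norm_complexify]; exact hu w) (fun w => by rw [norm_complexify]; exact hv w)
  have hnn : 0 ≤ C * Mu * Mv / ρ := by positivity
  rw [oseenFlatC_apply]
  refine (norm_integral_le_lintegral_norm _).trans ?_
  rw [← ENNReal.ofReal_le_ofReal_iff hnn, ENNReal.ofReal_toReal]
  · refine le_trans (le_of_eq (lintegral_congr fun w => ?_)) h
    rw [hpt w, ofReal_norm]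
  · exact ne_top_of_le_ne_top ENNReal.ofReal_ne_top
      (le_trans (le_of_eq (lintegral_congr fun w => by rw [hpt w, ofReal_norm])) h)

/-! ### The deformed-contour bound -/

/-- **The deformed-contour bound for flat Oseen potentials** (the estimate of
`OseenPotentialDeformedBound.lean` in the present notation). There is `C = C(n) > 0` such that:
for `ρ > 0`, real `x, y`, an open `Ω ⊆ ℂ^{n+1}`, fields `A, B` holomorphic on `Ω` whose real
traces are the densities, `A (cx w) = cx (u w)`, `B (cx w) = cx (v w)`, a profile `φ ∈ C¹_c` with
`|∂_yφ| ≤ L` whose graphs `cx w + iθφ(w)y` (`0 ≤ θ ≤ 1`) lie in `Ω`, the residual shift being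
admissible, `‖(φ w - 1)y‖ ≤ ‖x - w‖/2 + ρ`, and `‖A‖ ≤ M_A`, `‖B‖ ≤ M_B` on the graph `θ = 1`: if
the flat integrand is integrable, then `‖oseenFlatC ρ u v (cx x + i cx y)‖ ≤ (1 + L) (C M_A M_B / ρ)`.
[cite: BradshawGrujicKukavica2015, §3 Lemma 3.2 (the mechanism, in contour form)] -/
theorem exists_norm_oseenFlatC_le_of_holomorphic {n : ℕ} :
    ∃ C : ℝ, 0 < C ∧ ∀ {ρ : ℝ}, 0 < ρ → ∀ (x y : EuclideanSpace ℝ (Fin (n + 1)))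
      {Ω : Set (EuclideanSpace ℂ (Fin (n + 1)))}, IsOpen Ω →
      ∀ {A B : EuclideanSpace ℂ (Fin (n + 1)) → EuclideanSpace ℂ (Fin (n + 1))},
        DifferentiableOn ℂ A Ω → DifferentiableOn ℂ B Ω →
      ∀ {u v : EuclideanSpace ℝ (Fin (n + 1)) → EuclideanSpace ℝ (Fin (n + 1))},
        (∀ w, A (complexify w) = complexify (u w)) → (∀ w, B (complexify w) = complexify (v w)) →
      ∀ {φ : EuclideanSpace ℝ (Fin (n + 1)) → ℝ}, ContDiff ℝ 1 φ → HasCompactSupport φ →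
      ∀ {L : ℝ}, 0 ≤ L → (∀ w, |fderiv ℝ φ w y| ≤ L) →
      (∀ w, ∀ θ ∈ Icc (0 : ℝ) 1, complexify w + Complex.I • complexify ((θ * φ w) • y) ∈ Ω) →
      (∀ w, ‖(φ w - 1) • y‖ ≤ ‖x - w‖ / 2 + ρ) →
      ∀ {MA MB : ℝ}, 0 ≤ MA → 0 ≤ MB →
        (∀ w, ‖A (complexify w + Complex.I • complexify (φ w • y))‖ ≤ MA) →
        (∀ w, ‖B (complexify w + Complex.I • complexify (φ w • y))‖ ≤ MB) →
        Integrable (fun w => oseenKernelC (ρ : ℂ) (complexify x + Complex.I • complexify y - complexify w)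
          (complexify (u w)) (complexify (v w))) →
        ‖oseenFlatC ρ u v (complexify x + Complex.I • complexify y)‖ ≤ (1 + L) * (C * MA * MB / ρ) := by
  obtain ⟨C, hC, h⟩ := exists_norm_integral_oseenKernelC_flat_le (n := n)
  refine ⟨C, hC, fun {ρ} hρ x y {Ω} hΩ {A B} hA hB {u v} hAu hBv {φ} hφ hφc {L} hL hLφ hgraph hres
    {MA MB} hMA hMB hMA' hMB' hint => ?_⟩
  have e : oseenFlatC ρ u v (complexify x + Complex.I • complexify y) =
      ∫ w, oseenKernelC (ρ : ℂ) (complexify x + Complex.I • complexify y - complexify w)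
        (A (complexify w)) (B (complexify w)) := by
    rw [oseenFlatC_apply]
    refine integral_congr_ae (Eventually.of_forall fun w => ?_)
    show oseenKernelC (ρ : ℂ) (complexify x + Complex.I • complexify y - complexify w) (complexify (u w))
      (complexify (v w)) = oseenKernelC (ρ : ℂ) (complexify x + Complex.I • complexify y - complexify w)
      (A (complexify w)) (B (complexify w))
    rw [hAu, hBv]
  rw [e]
  refine h hρ x y hΩ hA hB hφ hφc hL hLφ hgraph hres hMA hMB hMA' hMB' ?_
  refine hint.congr (Eventually.of_forall fun w => ?_)
  show oseenKernelC (ρ : ℂ) (complexify x + Complex.I • complexify y - complexify w) (complexify (u w))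
      (complexify (v w)) = oseenKernelC (ρ : ℂ) (complexify x + Complex.I • complexify y - complexify w)
      (A (complexify w)) (B (complexify w))
  rw [hAu, hBv]

/-! ### Time integration of pointwise bounds -/

/-- **Time integration of a pointwise bound `K/√(t-s)`**: if the flat potentials at the times
`s ∈ (s₀, t)` are bounded by `K (t-s)^{-1/2}`, then `‖oseenDuhamelFlatC s₀ u v t ζ‖ ≤ K · 2√(t - s₀)`.
[folklore] -/
theorem norm_oseenDuhamelFlatC_le_of_forall {s₀ t : ℝ} (hst : s₀ < t)
    {u v : ℝ → EuclideanSpace ℝ ι → EuclideanSpace ℝ ι} {ζ : EuclideanSpace ℂ ι} {K : ℝ} (hK : 0 ≤ K)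
    (hb : ∀ s ∈ Ioo s₀ t, ‖oseenFlatC (Real.sqrt (t - s)) (u s) (v s) ζ‖ ≤ K * (t - s) ^ (-(1 / 2 : ℝ))) :
    ‖oseenDuhamelFlatC s₀ u v t ζ‖ ≤ K * (2 * Real.sqrt (t - s₀)) := by
  rw [oseenDuhamelFlatC_apply]
  have hnn : 0 ≤ K * (2 * Real.sqrt (t - s₀)) := by positivity
  refine (norm_integral_le_lintegral_norm _).trans ?_
  have hlin := setLIntegral_Ioo_sub_rpow_neg_half_of_lt hst
  have hle : ∫⁻ s in Ioo s₀ t, ENNReal.ofReal ‖oseenFlatC (Real.sqrt (t - s)) (u s) (v s) ζ‖ ≤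
      ENNReal.ofReal (K * (2 * Real.sqrt (t - s₀))) := by
    calc ∫⁻ s in Ioo s₀ t, ENNReal.ofReal ‖oseenFlatC (Real.sqrt (t - s)) (u s) (v s) ζ‖
        ≤ ∫⁻ s in Ioo s₀ t, ENNReal.ofReal K * ENNReal.ofReal ((t - s) ^ (-(1 / 2 : ℝ))) := by
          refine setLIntegral_mono' measurableSet_Ioo fun s hs => ?_
          rw [← ENNReal.ofReal_mul hK]
          exact ENNReal.ofReal_le_ofReal (hb s hs)
      _ = ENNReal.ofReal K * ∫⁻ s in Ioo s₀ t, ENNReal.ofReal ((t - s) ^ (-(1 / 2 : ℝ))) := by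
          rw [lintegral_const_mul' _ _ ENNReal.ofReal_ne_top]
      _ = ENNReal.ofReal (K * (2 * Real.sqrt (t - s₀))) := by
          rw [hlin, ← ENNReal.ofReal_mul hK]
  rw [← ENNReal.ofReal_le_ofReal_iff hnn,
    ENNReal.ofReal_toReal (ne_top_of_le_ne_top ENNReal.ofReal_ne_top hle)]
  exact hle

end Literature.Analysis.FluidPDE
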